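import Literature.MathematicalPhysics.QuantumFieldTheory.OSDistributionSpaceHolomorphicSemigroupLaw
import Literature.Analysis.UnboundedOperators.UnitaryRep
import HarnessLib

/-!
# The unitary time-translation group `V(s) = e^{isH}` on the OS Hilbert space

Osterwalder–Schrader I (CMP 31 (1973)), §4.1, p. 92: "Let `H` be the infinitesimal generator of
`T^t`. It is a positive self-adjoint operator on `ℋ` and we can define the one parameter group of
unitary operators `V^s = e^{isH}`, `−∞ < s < ∞`. This is the unitary representation of the time
translation group". With the holomorphic semigroup `e^{-τH} = holoShiftH hE1 τ` of parts I–III, the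
group is `V(s) := e^{-(-is)H} = holoShiftH hE1 (−is)` (`Re(−is) = 0`): this file packages it as a
strongly continuous one-parameter unitary group in the sense of the tree's
`Literature.Analysis.UnboundedOperators.OneParameterUnitaryGroup` (Stone vocabulary of `UnitaryRep`):

* `timeGroupOp hE1 s = holoShiftH hE1 (−is)`: group law, `V(0) = 1`, unitarity, strong
  continuity, `V(s)* = V(−s)`, `V(s) Ω = Ω`;
* `timeGroup hE1 : OneParameterUnitaryGroup ℋ` with `timeGroup_appReal`;
* the matrix elements: `⟪x, V(s) x⟫ = ∫ t^{−is} dν_x(t)` (`inner_timeGroupOp_self`, through the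
  diagonal `expectShiftC` of part I; `inner_holoShiftH_self` identifies `⟪x, e^{-τH} x⟫` with
  `expectShiftC x τ` on the closed half-plane) and `⟪V(s) x, V(t) x⟫ = ⟪x, V(t − s) x⟫`.

Positivity of the generator (`H ≥ 0`) is proved in the sequel from these formulas.

## References
* K. Osterwalder, R. Schrader, Axioms for Euclidean Green's functions, CMP 31 (1973), §4.1,
  p. 92 (`V^s = e^{isH}`).
-/

noncomputable section

open MeasureTheory Set Filter
open _root_.Topology
open scoped InnerProductSpace NNReal ComplexConjugate

-- CFC instance chain on `ℋ →L[ℂ] ℋ` (see `OSDistributionSpacePowers`).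
set_option synthInstance.maxHeartbeats 200000

namespace Literature.MathematicalPhysics.QuantumFieldTheory

variable {d : ℕ} [NeZero d]

section SchwingerFamily
open Literature.MathematicalPhysics.QuantumLattice (SchwingerFamily)
open Literature.MathematicalPhysics.QuantumLattice.SchwingerFamily
open Literature.MathematicalPhysics.QuantumLattice.SchwingerFamily.OSSpace
open Literature.Analysis.OperatorTheory
open Literature.Analysis.UnboundedOperators

variable {𝔖 : SchwingerFamily (EuclideanSpace ℝ (Fin d))} {hE2 : 𝔖.IsOSReflectionPositive}

/-! ## The operators `V(s) = e^{isH}` -/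

/-- The imaginary time `−is` has real part `0`. [folklore] -/
theorem re_neg_I_mul (s : ℝ) : (-(Complex.I * s) : ℂ).re = 0 := by simp

/-- `0 ≤ Re(−is)`. [folklore] -/
theorem re_neg_I_mul_nonneg (s : ℝ) : 0 ≤ (-(Complex.I * s) : ℂ).re := (re_neg_I_mul s).ge

/-- **The unitary time translation `V(s) = e^{isH}`** on the OS Hilbert space: the holomorphic
semigroup `e^{-τH}` at the imaginary time `τ = −is` (Osterwalder–Schrader I (1973), p. 92,
`V^s = e^{isH}`). [cite: OsterwalderSchraderCMP1973, §4.1 p. 92] -/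
def _root_.Literature.MathematicalPhysics.QuantumLattice.SchwingerFamily.OSSpace.timeGroupOp (hE1 : 𝔖.IsEuclideanCovariant) (s : ℝ) : OSHilbert 𝔖 hE2 →L[ℂ] OSHilbert 𝔖 hE2 :=
  holoShiftH hE1 (-(Complex.I * s))

/-- `V(0) = 1`. [folklore] -/
theorem _root_.Literature.MathematicalPhysics.QuantumLattice.SchwingerFamily.OSSpace.timeGroupOp_zero (hE1 : 𝔖.IsEuclideanCovariant) :
    timeGroupOp (hE2 := hE2) hE1 0 = 1 := by
  simp only [timeGroupOp, Complex.ofReal_zero, mul_zero, neg_zero, holoShiftH_zero hE1]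

/-- **Group law** `V(s + t) = V(s) V(t)` (semigroup law of `e^{-τH}` on the imaginary axis). [cite: OsterwalderSchraderCMP1973, §4.1 p. 92] -/
theorem _root_.Literature.MathematicalPhysics.QuantumLattice.SchwingerFamily.OSSpace.timeGroupOp_add (hE1 : 𝔖.IsEuclideanCovariant) (s t : ℝ) :
    timeGroupOp (hE2 := hE2) hE1 (s + t) = timeGroupOp hE1 s * timeGroupOp hE1 t := by
  simp only [timeGroupOp]
  rw [← holoShiftH_add hE1 (re_neg_I_mul_nonneg s) (re_neg_I_mul_nonneg t)]
  congr 1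
  push_cast
  ring

/-- **`V(s)` is unitary.** [cite: OsterwalderSchraderCMP1973, §4.1 p. 92] -/
theorem _root_.Literature.MathematicalPhysics.QuantumLattice.SchwingerFamily.OSSpace.timeGroupOp_mem_unitary (hE1 : 𝔖.IsEuclideanCovariant) (s : ℝ) :
    timeGroupOp (hE2 := hE2) hE1 s ∈ unitary (OSHilbert 𝔖 hE2 →L[ℂ] OSHilbert 𝔖 hE2) :=
  holoShiftH_mem_unitary hE1 (re_neg_I_mul s)

/-- `V(s)* = V(−s)`. [folklore] -/
theorem _root_.Literature.MathematicalPhysics.QuantumLattice.SchwingerFamily.OSSpace.adjoint_timeGroupOp (hE1 : 𝔖.IsEuclideanCovariant) (s : ℝ) :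
    ContinuousLinearMap.adjoint (timeGroupOp (hE2 := hE2) hE1 s) = timeGroupOp hE1 (-s) := by
  simp only [timeGroupOp]
  rw [adjoint_holoShiftH hE1 (re_neg_I_mul_nonneg s)]
  congr 1
  simp [Complex.conj_ofReal]

/-- `⟪V(s) x, y⟫ = ⟪x, V(−s) y⟫`. [folklore] -/
theorem _root_.Literature.MathematicalPhysics.QuantumLattice.SchwingerFamily.OSSpace.inner_timeGroupOp_left (hE1 : 𝔖.IsEuclideanCovariant) (s : ℝ) (x y : OSHilbert 𝔖 hE2) :
    ⟪timeGroupOp (hE2 := hE2) hE1 s x, y⟫_ℂ = ⟪x, timeGroupOp hE1 (-s) y⟫_ℂ := by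
  rw [← adjoint_timeGroupOp hE1 s, ContinuousLinearMap.adjoint_inner_right]

/-- `‖V(s) x‖ = ‖x‖`. [folklore] -/
theorem _root_.Literature.MathematicalPhysics.QuantumLattice.SchwingerFamily.OSSpace.norm_timeGroupOp_apply (hE1 : 𝔖.IsEuclideanCovariant) (s : ℝ) (x : OSHilbert 𝔖 hE2) :
    ‖timeGroupOp (hE2 := hE2) hE1 s x‖ = ‖x‖ :=
  norm_holoShiftH_apply_of_re_eq_zero hE1 (re_neg_I_mul s) x

/-- **Strong continuity**: `s ↦ V(s) x` is continuous (strong continuity of `e^{-τH}` on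
`{Re τ ≥ 0}` restricted to the imaginary axis). [cite: OsterwalderSchraderCMP1973, §4.1 p. 92] -/
theorem _root_.Literature.MathematicalPhysics.QuantumLattice.SchwingerFamily.OSSpace.continuous_timeGroupOp_apply (hE1 : 𝔖.IsEuclideanCovariant) (x : OSHilbert 𝔖 hE2) :
    Continuous fun s : ℝ => timeGroupOp (hE2 := hE2) hE1 s x := by
  have hc := continuousOn_holoShiftH_apply (hE2 := hE2) hE1 x
  have hg : Continuous fun s : ℝ => (-(Complex.I * s) : ℂ) := by fun_prop
  have hmap : MapsTo (fun s : ℝ => (-(Complex.I * s) : ℂ)) univ {τ : ℂ | 0 ≤ τ.re} :=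
    fun s _ => re_neg_I_mul_nonneg s
  change Continuous ((fun τ => holoShiftH (hE2 := hE2) hE1 τ x) ∘ fun s : ℝ => (-(Complex.I * s) : ℂ))
  exact hc.comp_continuous hg (fun s => hmap (mem_univ s))

/-- `V(s)` fixes the vacuum `Ω` (`e^{-τH} Ω = Ω`: on the real axis `shiftH t Ω = Ω`, transferred). [folklore] -/
theorem _root_.Literature.MathematicalPhysics.QuantumLattice.SchwingerFamily.OSSpace.holoShiftH_vacuum (hE1 : 𝔖.IsEuclideanCovariant) {τ : ℂ} (hτ : 0 ≤ τ.re) :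
    holoShiftH (hE2 := hE2) hE1 τ (vacuum 𝔖 hE2) = vacuum 𝔖 hE2 := by
  refine ext_inner_left ℂ fun x => ?_
  rw [inner_holoShiftH hE1 hτ]
  refine eq_of_eqOn_ofReal (differentiableOn_matrixElemC hE1 x _) (differentiableOn_const _)
    (continuousOn_matrixElemC hE1 x _) continuousOn_const (fun s hs => ?_) hτ
  rw [matrixElemC_ofReal hE1 _ _ hs, shiftH_vacuum hE1]

/-- `V(s) Ω = Ω`. [folklore] -/
theorem _root_.Literature.MathematicalPhysics.QuantumLattice.SchwingerFamily.OSSpace.timeGroupOp_vacuum (hE1 : 𝔖.IsEuclideanCovariant) (s : ℝ) :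
    timeGroupOp (hE2 := hE2) hE1 s (vacuum 𝔖 hE2) = vacuum 𝔖 hE2 :=
  holoShiftH_vacuum hE1 (re_neg_I_mul_nonneg s)

/-! ## The one-parameter unitary group -/

/-- `V` as a monoid homomorphism `Multiplicative ℝ →* (ℋ →L[ℂ] ℋ)`. [folklore] -/
def _root_.Literature.MathematicalPhysics.QuantumLattice.SchwingerFamily.OSSpace.timeGroupHom (hE1 : 𝔖.IsEuclideanCovariant) :
    Multiplicative ℝ →* (OSHilbert 𝔖 hE2 →L[ℂ] OSHilbert 𝔖 hE2) where
  toFun s := timeGroupOp (hE2 := hE2) hE1 (Multiplicative.toAdd s)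
  map_one' := by rw [toAdd_one, timeGroupOp_zero]
  map_mul' s t := by rw [toAdd_mul, timeGroupOp_add]

/-- **The strongly continuous unitary time-translation group `V^s = e^{isH}`** of the OS Hilbert
space (Osterwalder–Schrader I (1973), §4.1, p. 92: "the unitary representation of the time
translation group"), in the tree's Stone vocabulary `OneParameterUnitaryGroup`. [cite: OsterwalderSchraderCMP1973, §4.1 p. 92] -/
def _root_.Literature.MathematicalPhysics.QuantumLattice.SchwingerFamily.OSSpace.timeGroup (hE1 : 𝔖.IsEuclideanCovariant) :
    OneParameterUnitaryGroup (OSHilbert 𝔖 hE2) where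
  toMonoidHom := timeGroupHom (hE2 := hE2) hE1
  strongly_continuous x := (continuous_timeGroupOp_apply (hE2 := hE2) hE1 x).comp continuous_toAdd
  mem_unitary s := timeGroupOp_mem_unitary hE1 (Multiplicative.toAdd s)

/-- `(timeGroup hE1).appReal s = V(s) = holoShiftH hE1 (−is)`. [folklore] -/
@[simp]
theorem _root_.Literature.MathematicalPhysics.QuantumLattice.SchwingerFamily.OSSpace.timeGroup_appReal (hE1 : 𝔖.IsEuclideanCovariant) (s : ℝ) :
    (timeGroup (hE2 := hE2) hE1).appReal s = timeGroupOp hE1 s := rfl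

/-! ## Matrix elements through the spectral measure -/

/-- **Diagonal matrix elements of `e^{-τH}` are the power moments**: `⟪x, e^{-τH} x⟫ =
expectShiftC x τ = ∫ t^τ dν_x(t)` for `Re τ ≥ 0` (both sides holomorphic, equal on the real axis). [folklore] -/
theorem _root_.Literature.MathematicalPhysics.QuantumLattice.SchwingerFamily.OSSpace.inner_holoShiftH_self (hE1 : 𝔖.IsEuclideanCovariant) {τ : ℂ} (hτ : 0 ≤ τ.re) (x : OSHilbert 𝔖 hE2) :
    ⟪x, holoShiftH (hE2 := hE2) hE1 τ x⟫_ℂ = expectShiftC hE1 x τ := by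
  rw [inner_holoShiftH hE1 hτ]
  refine eq_of_eqOn_ofReal (differentiableOn_matrixElemC hE1 x x) (differentiableOn_expectShiftC hE1 x)
    (continuousOn_matrixElemC hE1 x x) (continuousOn_expectShiftC hE1 x) (fun s hs => ?_) hτ
  rw [matrixElemC_ofReal hE1 _ _ hs, expectShiftC_ofReal hE1 _ hs]

/-- **`⟪x, V(s) x⟫ = ∫ t^{−is} dν_x(t)`**: the matrix elements of the unitary time group are the
Fourier–Stieltjes transform of the spectral measure of `e^{-H}` in the variable `log t = −E`
(Osterwalder–Schrader I (1973), p. 92, `V^s = e^{isH}` via the spectral theorem; here via part I). [cite: OsterwalderSchraderCMP1973, §4.1 p. 92] -/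
theorem _root_.Literature.MathematicalPhysics.QuantumLattice.SchwingerFamily.OSSpace.inner_timeGroupOp_self (hE1 : 𝔖.IsEuclideanCovariant) (s : ℝ) (x : OSHilbert 𝔖 hE2) :
    ⟪x, timeGroupOp (hE2 := hE2) hE1 s x⟫_ℂ =
      ∫ t, (t : ℂ) ^ (-(Complex.I * s) : ℂ) ∂(osSpectralMeasureReal hE1 x) :=
  inner_holoShiftH_self hE1 (re_neg_I_mul_nonneg s) x

/-- `⟪V(s) x, V(t) x⟫ = ⟪x, V(t − s) x⟫` (unitarity and the group law). [folklore] -/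
theorem _root_.Literature.MathematicalPhysics.QuantumLattice.SchwingerFamily.OSSpace.inner_timeGroupOp_timeGroupOp (hE1 : 𝔖.IsEuclideanCovariant) (s t : ℝ) (x y : OSHilbert 𝔖 hE2) :
    ⟪timeGroupOp (hE2 := hE2) hE1 s x, timeGroupOp hE1 t y⟫_ℂ = ⟪x, timeGroupOp hE1 (t - s) y⟫_ℂ := by
  rw [inner_timeGroupOp_left hE1 s, ← mul_apply_eq_comp, ← timeGroupOp_add hE1]
  congr 2
  ring

end SchwingerFamily

end Literature.MathematicalPhysics.QuantumFieldTheory
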